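import Summits.Schanuel.Schanuel.Theorems.SoloInformedGenericGelfondInput

/-!
# Generic Gel'fond input at structured density `49/100`

Soloist file (informed mode, seat `solo-Schanuel-informed`, s182).  Verbatim copy of
`soloGG_gelfond_input` (`SoloInformedGenericGelfondInput`, AE-note §7 Steps 4–5 for an auxiliary
polynomial `R`) with the structured density `49/50` replaced by `49/100` — the density delivered
by the 3-term-progression rigidity theorem `soloAR_even_affine_of_few_violated_progressions`
(THEOREM C₃, even points only) through `soloG3S_structured_roots`.  Nothing else changes: the
cheap-factor pigeonhole `soloNC_exists_cheap_factor_on_progression` needs only `#S' > K/5`.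

`soloG3G_gelfond_input`: `ξ` transcendental, `K ≥ 1000`, `R ≠ 0` with `deg R ≤ D₀`,
`log M(R) ≤ L₀` (`D₀, L₀ > 0`), `S' ⊆ [1, K]` with `#S' ≥ (49/100) K`, `μ ≠ 0`, every
`γ + sμ` (`s ∈ S'`) a root of `R` within `exp(-W)` of `sξ`, and
`20 D₀/K · log(K‖ξ‖ + 1) + 20 L₀/K ≤ W/2`  ⟹  a non-zero `Q ∈ ℤ[X]` with `deg Q ≤ 20 D₀/K`,
`t(Q) ≤ 20 D₀/K (2 + log K) + 20 L₀/K` and `|Q(ξ)| ≤ exp(-W/2)` — the input of Gel'fond's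
criterion [cite: Roy2010, Lemma 2.2] (in the tree: `gelfond_criterion_not_small_values`).

What this is NOT.  Nothing here bears on `Literature.Periods.SchanuelConjecture` (the seat's
verdict, no path, is unchanged); the node [cite: Roy2010, Thm 1.1] is not claimed.  Tree files
and Mathlib only; no definitions, no literature hypothesis; axioms the standard three.
-/

namespace Summit.Schanuel.Schanuel.Theorems

open Polynomial Finset

/-- **Generic Gel'fond input at density `49/100` (AE-note §14; Steps 4–5 for an auxiliary
`R`).**  See the module docstring for the statement in words. -/
theorem soloG3G_gelfond_input {ξ : ℂ} (hξ : Transcendental ℚ ξ) {K : ℕ} (hK : 1000 ≤ K)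
    {R : ℤ[X]} (hR0 : R ≠ 0) {D₀ L₀ : ℝ} (hD₀ : 0 < D₀) (hL₀ : 0 < L₀)
    (hD : (R.natDegree : ℝ) ≤ D₀) (hL : Real.log (R.map (Int.castRingHom ℂ)).mahlerMeasure ≤ L₀)
    {W : ℝ} {S' : Finset ℕ} (hS'sub : S' ⊆ Icc 1 K) (hS'card : (49 : ℝ) / 100 * K ≤ #S')
    {γ μ : ℂ} (hμ : μ ≠ 0)
    (hroots : ∀ s ∈ S', aeval (γ + (s : ℂ) * μ) R = 0 ∧
      ‖(γ + (s : ℂ) * μ) - (s : ℂ) * ξ‖ ≤ Real.exp (-W))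
    (h₆ : 20 * D₀ / K * Real.log (K * ‖ξ‖ + 1) + 20 * L₀ / K ≤ W / 2) :
    ∃ Q : ℤ[X], Q ≠ 0 ∧ (Q.natDegree : ℝ) ≤ 20 * D₀ / K ∧
      Q.gelfondType ≤ 20 * D₀ / K * (2 + Real.log K) + 20 * L₀ / K ∧
      ‖aeval ξ Q‖ ≤ Real.exp (-(W / 2)) := by
  have hK0 : (0 : ℝ) < K := by exact_mod_cast (show 0 < K by omega)
  have hK1 : (1 : ℝ) ≤ K := by exact_mod_cast (show 1 ≤ K by omega)
  -- Step 4: a cheap irreducible factor through one of the structured roots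
  have hd₀ : (0 : ℝ) < 20 * D₀ / K := by positivity
  have hh₀ : (0 : ℝ) < 20 * L₀ / K := by positivity
  have hlogM0 : 0 ≤ Real.log (R.map (Int.castRingHom ℂ)).mahlerMeasure :=
    Real.log_nonneg (Polynomial.one_le_mahlerMeasure_of_ne_zero hR0)
  have hbudget : 2 * (R.natDegree / (20 * D₀ / K) +
      Real.log (R.map (Int.castRingHom ℂ)).mahlerMeasure / (20 * L₀ / K)) < #S' := by
    have hd : (R.natDegree : ℝ) / (20 * D₀ / K) ≤ K / 20 := by
      rw [div_le_iff₀ hd₀]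
      calc (R.natDegree : ℝ) ≤ D₀ := hD
        _ = K / 20 * (20 * D₀ / K) := by field_simp
    have hh : Real.log (R.map (Int.castRingHom ℂ)).mahlerMeasure / (20 * L₀ / K) ≤ K / 20 := by
      rw [div_le_iff₀ hh₀]
      calc Real.log (R.map (Int.castRingHom ℂ)).mahlerMeasure ≤ L₀ := hL
        _ = K / 20 * (20 * L₀ / K) := by field_simp
    linarith
  obtain ⟨s, hs, q, hqirr, -, -, hqval, hqd, hqh⟩ :=
    soloNC_exists_cheap_factor_on_progression R hR0 γ μ hμ S' (fun s hs => (hroots s hs).1)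
      hd₀ hh₀ hbudget
  have hq0 : q ≠ 0 := hqirr.ne_zero
  have hs1 : 1 ≤ s := (Finset.mem_Icc.mp (hS'sub hs)).1
  have hsK : s ≤ K := (Finset.mem_Icc.mp (hS'sub hs)).2
  -- Step 5: the dilated factor `q(sT)`
  obtain ⟨Q, hQ0, hQdeg, hQtype, -, hQval⟩ :=
    soloDF_package hξ q hq0 hqval hs1 hsK (Real.exp_pos _).le (hroots s hs).2
  refine ⟨Q, hQ0, ?_, ?_, ?_⟩
  · rw [hQdeg]; exact hqd
  · have hlogK : 0 ≤ 2 + Real.log K := by linarith [Real.log_nonneg hK1]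
    calc Q.gelfondType ≤ q.natDegree * (2 + Real.log K) +
          Real.log (q.map (Int.castRingHom ℂ)).mahlerMeasure := hQtype
      _ ≤ 20 * D₀ / K * (2 + Real.log K) + 20 * L₀ / K :=
          add_le_add (mul_le_mul_of_nonneg_right hqd hlogK) hqh
  · have hM0 : 0 < (q.map (Int.castRingHom ℂ)).mahlerMeasure :=
      zero_lt_one.trans_le (Polynomial.one_le_mahlerMeasure_of_ne_zero hq0)
    have hB0 : 0 < (K : ℝ) * ‖ξ‖ + 1 := by positivity
    have hL0 : 0 ≤ Real.log ((K : ℝ) * ‖ξ‖ + 1) :=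
      Real.log_nonneg (by nlinarith [norm_nonneg ξ])
    have hrew : Real.exp (-W) * ((K : ℝ) * ‖ξ‖ + 1) ^ q.natDegree *
        (q.map (Int.castRingHom ℂ)).mahlerMeasure =
        Real.exp (-W + q.natDegree * Real.log ((K : ℝ) * ‖ξ‖ + 1) +
          Real.log (q.map (Int.castRingHom ℂ)).mahlerMeasure) := by
      rw [Real.exp_add, Real.exp_add, Real.exp_nat_mul, Real.exp_log hB0, Real.exp_log hM0]
    refine hQval.trans ?_
    rw [hrew, Real.exp_le_exp]
    have h7 : (q.natDegree : ℝ) * Real.log ((K : ℝ) * ‖ξ‖ + 1) ≤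
        20 * D₀ / K * Real.log ((K : ℝ) * ‖ξ‖ + 1) := mul_le_mul_of_nonneg_right hqd hL0
    linarith

end Summit.Schanuel.Schanuel.Theorems
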